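import Summits.QuantumAdvantage.AdviceFreeQNC0.CrossFreeWindowPolylog
import Literature.Computability.MetaComplexity.RazborovSmolenskyPoly
import HarnessLib

/-!
# Cell qa-qnc0 (odd primes, rung R1): WINDOW-LOCAL walk strategies of ANY complexity lose — `WindowLocalHardU`

Planner qa-qnc0-p2 g13, ROUND-13 §2 rung R1 / `line13/Sketch13p2.lean` §2 (statements `WindowLocal`,
`WindowLocalHardU` VERBATIM).  PROVED here:

* `ind_mem_lowDeg_of_dependsOn` — the JUNTA-DEGREE LEMMA (any field `F`): a Boolean function that depends only
  on the coordinates in a set `S` has an indicator of `F`-degree `≤ |S|` (expand over the `S`-patterns `a`: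
  `[f] = Σ_{a ⊆ S, f(a)} Π_{i∈S} (x_i if a_i else 1 − x_i)`).
* **`windowLocalHardU : WindowLocalHardU`** — a walk strategy each of whose outputs `y_g` reads only the bits
  `u_i` with `g − (log₂ n)^C ≤ i < g + (log₂ n)^C` wins the u-walk game (`ringWinU`, every charge) on at most
  `θ·2ⁿ` inputs, ONE `θ < 1` for all `C`, for players of ANY field or complexity: a `2(log₂ n)^C`-junta has
  `𝔽₂`-degree `≤ 2(log₂ n)^C ≤ (log₂ n)^{C+1}` (`n ≥ 4`), so the tree's LOCAL-RULES THEOREM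
  `ringWinU_localRules_le` (`CrossFreeWindowPolylog.lean`, qn-prover-3 g3) applies with exponent `C + 1`.

So for every prime `p` (indeed with no algebra at all) LOCAL rules cannot win α's walk game; with g10's `TwoShotHardF`
and the sparse/gapped rungs R3/R4 this brackets the open dense non-local crux `WalkHardF p` (`p ≥ 5`, ROUND-13 §3).
WHAT THIS IS NOT: nothing on non-local players (`WalkHardF p`, `WalkHardFAnchored p` need `ElimHardF p`); the sharp
`2/3` law `WindowLocalTwoThirdsU` is not proved here; separation NOT moved.
-/

noncomputable section

namespace Summit.QuantumAdvantage.AdviceFreeQNC0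

open Classical
open Finset
open Literature.Computability.MetaComplexity Literature.Computability.MetaComplexity.Smolensky

variable {n : ℕ}

/-! ### Statements (planner qa-qnc0-p2 Sketch13p2 §2, verbatim) -/

/-- `y` is `ℓ`-window-local: output `g` depends only on the bits `u_i` with `g − ℓ ≤ i < g + ℓ`.
(Sketch13p2 §2, verbatim.) -/
def WindowLocal (ℓ : ℕ) (y : Fin (n + 1) → (Fin n → Bool) → Bool) : Prop :=
  ∀ g : Fin (n + 1), ∀ u v : Fin n → Bool,
    (∀ i : Fin n, g.val ≤ i.val + ℓ → i.val < g.val + ℓ → u i = v i) → y g u = y g v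

/-- **`WindowLocalHardU`** (S from the tree, FIELD-FREE): a strategy whose every output reads only the bits within
distance `(log₂ n)^C` of its cut wins at most `θ·2ⁿ`, one `θ < 1` for all `C` — for players of ANY field or complexity,
since a `2(log₂ n)^C`-junta has `𝔽₂`-degree `≤ 2(log₂ n)^C ≤ (log₂ n)^{C+1}` and the tree's LOCAL-RULES THEOREM
`ringWinU_localRules_le` (`CrossFreeWindowPolylog.lean:168`, hypotheses `HasDeg (y g) ((log₂ n)^C)` + this locality)
applies with `C + 1`.  PROVED: `windowLocalHardU`. (Sketch13p2 §2, verbatim.) -/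
def WindowLocalHardU : Prop :=
  ∃ θ : ℝ, θ < 1 ∧ ∀ C : ℕ, ∃ n₀ : ℕ, ∀ n ≥ n₀, ∀ c : ℕ, ∀ y : Fin (n + 1) → (Fin n → Bool) → Bool,
    WindowLocal ((Nat.log 2 n) ^ C) y →
      ((univ.filter fun u : Fin n → Bool => ringWinU c y u = true).card : ℝ) ≤ θ * (2 : ℝ) ^ n

/-! ### The junta-degree lemma (any field) -/

section Junta

variable {F : Type*} [Field F]

/-- The pattern factor `x_i` (if `a_i = 1`) or `1 − x_i` (if `a_i = 0`): degree `≤ 1`. -/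
private theorem patternFactor_mem_lowDeg (a : Fin n → Bool) (i : Fin n) :
    (fun u : Fin n → Bool => if u i = a i then (1 : F) else 0) ∈ lowDeg F n 1 := by
  cases ha : a i
  · have heq : (fun u : Fin n → Bool => if u i = false then (1 : F) else 0) =
        1 - fun u => if u i then (1 : F) else 0 := by
      funext u
      by_cases hu : u i = true
      · simp [hu]
      · simp [hu]
    rw [heq]
    exact Submodule.sub_mem _ (one_mem_lowDeg 1) (bitFn_mem_lowDeg i le_rfl)
  · exact bitFn_mem_lowDeg i le_rfl

/-- The indicator of "`u` agrees with `a` on `S`" has degree `≤ |S|`. -/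
private theorem agreeOn_mem_lowDeg (S : Finset (Fin n)) (a : Fin n → Bool) :
    (fun u : Fin n → Bool => if (∀ i ∈ S, u i = a i) then (1 : F) else 0) ∈ lowDeg F n S.card := by
  have heq : (fun u : Fin n → Bool => if (∀ i ∈ S, u i = a i) then (1 : F) else 0) =
      ∏ i ∈ S, (fun u : Fin n → Bool => if u i = a i then (1 : F) else 0) := by
    funext u
    rw [Finset.prod_apply, Finset.prod_boole]
    congr 1
  rw [heq]
  have h := prod_mem_lowDeg S (D := 1) (u := fun i => fun u : Fin n → Bool => if u i = a i then (1 : F) else 0)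
    (fun i _ => patternFactor_mem_lowDeg a i)
  rwa [Nat.mul_one] at h

/-- **Junta-degree lemma**: if `f` depends only on the coordinates in `S`, its indicator has `F`-degree
`≤ |S|`. -/
theorem ind_mem_lowDeg_of_dependsOn (S : Finset (Fin n)) (f : (Fin n → Bool) → Bool)
    (hf : ∀ u v : Fin n → Bool, (∀ i ∈ S, u i = v i) → f u = f v) :
    (fun u : Fin n → Bool => if f u = true then (1 : F) else 0) ∈ lowDeg F n S.card := by
  -- the `S`-patterns on which `f` is true
  set A : Finset (Fin n → Bool) :=
    univ.filter fun a : Fin n → Bool => (∀ i, i ∉ S → a i = false) ∧ f a = true with hA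
  have heq : (fun u : Fin n → Bool => if f u = true then (1 : F) else 0) =
      ∑ a ∈ A, fun u : Fin n → Bool => if (∀ i ∈ S, u i = a i) then (1 : F) else 0 := by
    funext u
    rw [Finset.sum_apply]
    -- the projection of `u` onto `S`
    set a₀ : Fin n → Bool := fun i => if i ∈ S then u i else false with ha₀
    have hagree : ∀ i ∈ S, u i = a₀ i := fun i hi => by rw [ha₀]; simp [hi]
    have hfu : f u = f a₀ := hf u a₀ hagree
    -- only `a₀` can agree with `u` on `S` among the patterns supported on `S`
    have huniq : ∀ a ∈ A, (∀ i ∈ S, u i = a i) → a = a₀ := by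
      intro a ha h
      rw [hA, mem_filter] at ha
      funext i
      by_cases hi : i ∈ S
      · rw [← h i hi, hagree i hi]
      · rw [ha.2.1 i hi, ha₀]; simp [hi]
    by_cases hfa : f u = true
    · rw [if_pos hfa]
      have ha₀A : a₀ ∈ A := by
        rw [hA, mem_filter]
        refine ⟨mem_univ _, fun i hi => by rw [ha₀]; simp [hi], ?_⟩
        rw [← hfu]; exact hfa
      rw [← Finset.add_sum_erase A _ ha₀A, if_pos hagree]
      rw [Finset.sum_eq_zero (fun a ha => ?_), add_zero]
      rw [Finset.mem_erase] at ha
      rw [if_neg (fun h => ha.1 (huniq a ha.2 h))]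
    · rw [if_neg hfa]
      refine (Finset.sum_eq_zero fun a ha => ?_).symm
      rw [if_neg]
      intro h
      have := huniq a ha h
      rw [hA, mem_filter] at ha
      rw [this, ← hfu] at ha
      exact hfa ha.2.2
  rw [heq]
  exact Submodule.sum_mem _ fun a _ => agreeOn_mem_lowDeg S a

end Junta

/-! ### R1: window-local strategies lose -/

/-- The window of cut `g` at range `ℓ` has at most `2ℓ` bits. -/
private theorem card_window_le (g ℓ : ℕ) :
    (univ.filter fun i : Fin n => g ≤ i.val + ℓ ∧ i.val < g + ℓ).card ≤ 2 * ℓ := by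
  calc (univ.filter fun i : Fin n => g ≤ i.val + ℓ ∧ i.val < g + ℓ).card
      ≤ (Finset.range (2 * ℓ)).card := by
        refine Finset.card_le_card_of_injOn (fun i => i.val + ℓ - g) ?_ ?_
        · intro i hi
          rw [Finset.mem_coe, mem_filter] at hi
          rw [Finset.mem_coe, Finset.mem_range]
          show i.val + ℓ - g < 2 * ℓ
          omega
        · intro i hi i' hi' h
          rw [Finset.mem_coe, mem_filter] at hi hi'
          have h' : i.val + ℓ - g = i'.val + ℓ - g := h
          exact Fin.ext (by omega)
    _ = 2 * ℓ := Finset.card_range _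

/-- A window-local output is a junta on its window, hence has `𝔽₂`-degree `≤ 2ℓ`. -/
theorem hasDeg_of_windowLocal {ℓ : ℕ} {y : Fin (n + 1) → (Fin n → Bool) → Bool}
    (hy : WindowLocal ℓ y) (g : Fin (n + 1)) : HasDeg (y g) (2 * ℓ) := by
  unfold HasDeg
  have h := ind_mem_lowDeg_of_dependsOn (F := ZMod 2)
    (univ.filter fun i : Fin n => g.val ≤ i.val + ℓ ∧ i.val < g.val + ℓ) (y g)
    (fun u v huv => hy g u v (fun i h1 h2 => huv i (by rw [mem_filter]; exact ⟨mem_univ _, h1, h2⟩)))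
  exact lowDeg_mono (card_window_le g.val ℓ) h

/-- **R1 `WindowLocalHardU` — PROVED** (field-free): window-local strategies of range `(log₂ n)^C` win α's walk
game on at most `θ·2ⁿ` inputs, one `θ < 1` for all `C`. -/
theorem windowLocalHardU : WindowLocalHardU := by
  obtain ⟨θ, hθ, H⟩ := ringWinU_localRules_le
  refine ⟨θ, hθ, fun C => ?_⟩
  obtain ⟨n₀, hn₀⟩ := H (C + 1)
  refine ⟨max n₀ 4, fun n hn c y hy => ?_⟩
  have hn₀n : n₀ ≤ n := le_trans (le_max_left _ _) hn
  have hlog : 2 ≤ Nat.log 2 n := Nat.le_log_of_pow_le (by norm_num) (le_trans (le_max_right _ _) hn)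
  have hmono : (Nat.log 2 n) ^ C ≤ (Nat.log 2 n) ^ (C + 1) :=
    Nat.pow_le_pow_right (by omega) (Nat.le_succ C)
  have hdeg2 : 2 * (Nat.log 2 n) ^ C ≤ (Nat.log 2 n) ^ (C + 1) := by
    rw [pow_succ]; nlinarith [Nat.one_le_pow C (Nat.log 2 n) (by omega)]
  refine hn₀ n hn₀n c y (fun g => ?_) (fun g u u' huu' => ?_)
  · exact lowDeg_mono hdeg2 (hasDeg_of_windowLocal hy g)
  · exact hy g u u' (fun i h1 h2 => huu' i (by omega) (by omega))

end Summit.QuantumAdvantage.AdviceFreeQNC0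

end
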